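import Mathlib.Analysis.Calculus.FDeriv.Symmetric
import Literature.Analysis.FluidPDE.ElgindiLinearizedOperator
import HarnessLib

/-!
# Second-order calculus on the quarter strip: `D_θD_z = D_zD_θ`, integration by parts in `θ`,
and the `θ`-weighted energy identity for `𝓛`

Topic `Literature/Analysis/FluidPDE`. Support file (everything proved, no definitions, no named
facts) on the proof path of the named fact
`Literature.Analysis.FluidPDE.Elgindi.ElgindiGhoulMasmoudi2021_stabilityCore`
(`ElgindiStabilityDecomposition.lean`). From [Elgindi2021] §6 on (T. M. Elgindi, Ann. of Math. 194
(2021) = arXiv:1904.04795, §6.1 Prop. 6.5 ff., p. 16–19 of the held text) and throughout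
Elgindi–Ghoul–Masmoudi, Camb. J. Math. 9 (2021) (§3: "`D_θ` commutes with `𝓛_{F_*}^T` with the
exception of the last term"; "we then integrate by parts using the definition of `W`"), the
coercivity estimates pair `D_θ^iD_z^j` of the equation with `D_θ^iD_z^j f` against weights
`w²/sin(2θ)^γ`, `w²/sin(2θ)^η`. Three pieces of calculus are used silently there and are proved
here, for the curried functions and slice operators of the tree (`Elgindi.dz`, `Elgindi.dθ`,
`Elgindi.Dz = z∂_z`, `Elgindi.Dθ = sin(2θ)∂_θ`, `ElgindiWeightedSpaces.lean`,
`ElgindiSelfSimilarEquations.lean`):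

* **mixed partials commute** on the open strip for `C²` functions (`dθ_dz_eq_dz_dθ`, from
  Mathlib's symmetry of the second derivative), hence **`D_θD_z f = D_zD_θ f`** there
  (`Dθ_Dz_comm`; [ElgindiGhoulMasmoudi2021] §1.7 / `ElgindiWeightedSpaces.lean`: "the two
  operators act on different variables and commute on smooth functions");
* **integration by parts in `θ`** for functions compactly supported inside the open strip:
  `∬ ∂_θH = 0` (`integral_deriv_slice_snd_eq_zero`) and, with a weight `u ∈ C¹(0, π/2)`,
  `∬_strip u(θ)∂_θG = −∬_strip u'(θ)G` (`integral_strip_weight_mul_deriv_slice_snd`) — the step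
  "The third term comes from integrating the transport term by parts" of the proof of
  [Elgindi2021] Prop. 6.5 (weight `sin(2θ)^{1−γ}`);
* the **`θ`-weighted energy identity** `∬_strip 𝓛(f)·f·w²ρ(θ) = ½∬_strip (fw)²ρ(θ)` for a weight
  `ρ ∈ C¹(0, π/2)` (`integral_strip_opL_energy_weight`), extending `integral_strip_opL_energy`
  (`ρ ≡ 1`, `ElgindiLinearizedOperator.lean`): (LW) acts in `z` only, so any `θ`-weight passes
  through — the first term "`½|(D_θf)w/√(sin(2θ)^γ)|²`" of the proof of Prop. 6.5 and
  "`(I₁, D_z(f)w²/sin(2θ)^η) ≥ ½|D_zf w/√(sin(2θ)^η)|²`" of Prop. 6.9.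

Used from Mathlib: `ContDiffAt.isSymmSndFDerivAt`, `fderiv_clm_apply`, `integral_prod`,
`integral_of_hasDerivAt_of_tendsto`.
-/

noncomputable section

open MeasureTheory Set Function Real Filter
open _root_.Topology

namespace Literature.Analysis.FluidPDE

namespace Elgindi

/-! ### Mixed partial derivatives commute on the open strip -/

/-- A slice identity near a point: if two functions on the plane agree near `p`, their `θ`-slices
through `p.1` agree near `p.2`. [folklore] -/
theorem eventuallyEq_slice_snd {G₁ G₂ : ℝ × ℝ → ℝ} {p : ℝ × ℝ} (h : G₁ =ᶠ[𝓝 p] G₂) :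
    (fun θ => G₁ (p.1, θ)) =ᶠ[𝓝 p.2] fun θ => G₂ (p.1, θ) := by
  have hc : Continuous fun θ : ℝ => (p.1, θ) := by fun_prop
  exact hc.continuousAt.tendsto.eventually (show ∀ᶠ q in 𝓝 (p.1, p.2), G₁ q = G₂ q from h)

/-- The same for `z`-slices. [folklore] -/
theorem eventuallyEq_slice_fst {G₁ G₂ : ℝ × ℝ → ℝ} {p : ℝ × ℝ} (h : G₁ =ᶠ[𝓝 p] G₂) :
    (fun z => G₁ (z, p.2)) =ᶠ[𝓝 p.1] fun z => G₂ (z, p.2) := by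
  have hc : Continuous fun z : ℝ => (z, p.2) := by fun_prop
  exact hc.continuousAt.tendsto.eventually (show ∀ᶠ q in 𝓝 (p.1, p.2), G₁ q = G₂ q from h)

/-- **`∂_θ∂_z f = ∂_z∂_θ f` on the open strip for `f ∈ C²(strip)`** (Schwarz; both sides are the
second Fréchet derivative of `uncurry f` on the pair `(1,0), (0,1)`). [folklore] -/
theorem dθ_dz_eq_dz_dθ {f : ℝ → ℝ → ℝ} (hf : ContDiffOn ℝ 2 (uncurry f) strip) {p : ℝ × ℝ}
    (hp : p ∈ strip) : dθ (dz f) p.1 p.2 = dz (dθ f) p.1 p.2 := by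
  set F : ℝ × ℝ → ℝ := uncurry f with hF
  have hFat : ContDiffAt ℝ 2 F p := hf.contDiffAt (strip_mem_nhds hp)
  have hsym : IsSymmSndFDerivAt ℝ F p := hFat.isSymmSndFDerivAt (by simp)
  -- near `p`, the slice derivatives are the Fréchet derivative on the basis vectors
  have hev : ∀ᶠ q in 𝓝 p, q ∈ strip := strip_mem_nhds hp
  have e1 : (fun q : ℝ × ℝ => dz f q.1 q.2) =ᶠ[𝓝 p] fun q => fderiv ℝ F q (1, 0) :=
    hev.mono fun q hq => dz_eq_fderiv (differentiableAt_of_contDiffOn_strip hf (by simp) hq)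
  have e2 : (fun q : ℝ × ℝ => dθ f q.1 q.2) =ᶠ[𝓝 p] fun q => fderiv ℝ F q (0, 1) :=
    hev.mono fun q hq => dθ_eq_fderiv (differentiableAt_of_contDiffOn_strip hf (by simp) hq)
  -- `DF` is differentiable at `p`
  have hG : DifferentiableAt ℝ (fderiv ℝ F) p :=
    (hFat.fderiv_right (m := 1) (by norm_num)).differentiableAt one_ne_zero
  have hG1 : DifferentiableAt ℝ (fun q => fderiv ℝ F q (1, 0)) p :=
    hG.clm_apply (differentiableAt_const _)
  have hG2 : DifferentiableAt ℝ (fun q => fderiv ℝ F q (0, 1)) p :=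
    hG.clm_apply (differentiableAt_const _)
  have hD1 : fderiv ℝ (fun q => fderiv ℝ F q (1, 0)) p (0, 1) = fderiv ℝ (fderiv ℝ F) p (0, 1) (1, 0) := by
    rw [fderiv_clm_apply hG (differentiableAt_const _)]
    simp
  have hD2 : fderiv ℝ (fun q => fderiv ℝ F q (0, 1)) p (1, 0) = fderiv ℝ (fderiv ℝ F) p (1, 0) (0, 1) := by
    rw [fderiv_clm_apply hG (differentiableAt_const _)]
    simp
  -- left side: `∂_θ` of the slice of `∂_z f`
  have hL : dθ (dz f) p.1 p.2 = fderiv ℝ (fderiv ℝ F) p (0, 1) (1, 0) := by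
    rw [dθ, (eventuallyEq_slice_snd e1).deriv_eq, (hasDerivAt_slice_snd hG1).deriv, hD1]
  have hR : dz (dθ f) p.1 p.2 = fderiv ℝ (fderiv ℝ F) p (1, 0) (0, 1) := by
    rw [dz, (eventuallyEq_slice_fst e2).deriv_eq, (hasDerivAt_slice_fst hG2).deriv, hD2]
  rw [hL, hR, hsym (0, 1) (1, 0)]

/-- **`D_θD_z f = D_zD_θ f` on the open strip for `f ∈ C²(strip)`**
(`D_z = z∂_z`, `D_θ = sin(2θ)∂_θ` act on different variables). [cite: ElgindiGhoulMasmoudi2021, §1.7 (p. 6 of arXiv:1910.14071): the operators D_R, D_θ of the 𝓗ᵏ norm] -/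
theorem Dθ_Dz_comm {f : ℝ → ℝ → ℝ} (hf : ContDiffOn ℝ 2 (uncurry f) strip) {p : ℝ × ℝ}
    (hp : p ∈ strip) : Dθ (Dz f) p.1 p.2 = Dz (Dθ f) p.1 p.2 := by
  have h1 : ContDiffOn ℝ 1 (uncurry (dz f)) strip := contDiffOn_dz (n := 1) hf
  have h2 : ContDiffOn ℝ 1 (uncurry (dθ f)) strip := contDiffOn_dθ (n := 1) hf
  -- the slices of `∂_z f` in `θ` and of `∂_θ f` in `z` are differentiable at `p`
  have hdz : DifferentiableAt ℝ (fun θ => dz f p.1 θ) p.2 :=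
    (hasDerivAt_slice_snd (differentiableAt_of_contDiffOn_strip h1 one_ne_zero hp)).differentiableAt
  have hdθ : DifferentiableAt ℝ (fun z => dθ f z p.2) p.1 :=
    (hasDerivAt_slice_fst (differentiableAt_of_contDiffOn_strip h2 one_ne_zero hp)).differentiableAt
  have eL : Dθ (Dz f) p.1 p.2 = Real.sin (2 * p.2) * (p.1 * dθ (dz f) p.1 p.2) := by
    rw [Dθ_eq_mul_dθ]
    congr 1
    simp only [dθ, Dz_eq_mul_dz]
    exact deriv_const_mul p.1 hdz
  have eR : Dz (Dθ f) p.1 p.2 = p.1 * (Real.sin (2 * p.2) * dz (dθ f) p.1 p.2) := by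
    rw [Dz_eq_mul_dz]
    congr 1
    simp only [dz, Dθ_eq_mul_dθ]
    exact deriv_const_mul _ hdθ
  rw [eL, eR, dθ_dz_eq_dz_dθ hf hp]
  ring

/-! ### Integration by parts in `θ` -/

/-- **`∬ ∂_θH dz dθ = 0`** for `H ∈ C¹(ℝ²)` with compact support (Fubini and `∫ h' = 0` on each
`z`-slice). [folklore] -/
theorem integral_deriv_slice_snd_eq_zero {H : ℝ × ℝ → ℝ} (hH : ContDiff ℝ 1 H)
    (hsupp : HasCompactSupport H) : ∫ p : ℝ × ℝ, deriv (fun θ => H (p.1, θ)) p.2 = 0 := by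
  have hder : ∀ p : ℝ × ℝ, deriv (fun θ => H (p.1, θ)) p.2 = fderiv ℝ H p (0, 1) := fun p =>
    (hasDerivAt_slice_snd ((hH.differentiable (by norm_num)) p)).deriv
  have hDc : Continuous fun p : ℝ × ℝ => fderiv ℝ H p (0, 1) :=
    (hH.continuous_fderiv one_ne_zero).clm_apply continuous_const
  have hDs : HasCompactSupport fun p : ℝ × ℝ => fderiv ℝ H p (0, 1) :=
    hsupp.fderiv (𝕜 := ℝ) |>.comp_left (g := fun L : ℝ × ℝ →L[ℝ] ℝ => L (0, 1)) (by simp)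
  have hI : Integrable fun p : ℝ × ℝ => deriv (fun θ => H (p.1, θ)) p.2 :=
    (hDc.integrable_of_hasCompactSupport hDs).congr (Eventually.of_forall fun p => by simp only [hder])
  rw [Measure.volume_eq_prod] at hI ⊢
  rw [integral_prod _ hI]
  have hzero : ∀ z : ℝ, ∫ θ, deriv (fun θ' => H ((z, θ).1, θ')) (z, θ).2 = 0 := by
    intro z
    have hsl : ContDiff ℝ 1 fun θ => H (z, θ) := hH.comp (contDiff_prodMk_right z)
    have hsls : HasCompactSupport fun θ => H (z, θ) :=
      HasCompactSupport.of_support_subset_isCompact (hsupp.image continuous_snd) fun θ hθ =>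
        ⟨(z, θ), subset_tsupport H hθ, rfl⟩
    have hd : ∀ θ, HasDerivAt (fun θ => H (z, θ)) (deriv (fun θ => H (z, θ)) θ) θ := fun θ =>
      ((hsl.differentiable (by norm_num)) θ).hasDerivAt
    have hi : Integrable fun θ => deriv (fun θ => H (z, θ)) θ :=
      hsl.continuous_deriv_one.integrable_of_hasCompactSupport hsls.deriv
    have h0 : Tendsto (fun θ => H (z, θ)) (cocompact ℝ) (𝓝 0) := hsls.is_zero_at_infty
    have := integral_of_hasDerivAt_of_tendsto hd hi (h0.mono_left atBot_le_cocompact)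
      (h0.mono_left atTop_le_cocompact)
    simpa using this
  simp [hzero]

/-- **Integration by parts in `θ` on the strip with a weight**: for `G ∈ C¹(strip)` compactly
supported inside the open strip and `u ∈ C¹(0, π/2)`,
`∬_strip u(θ)∂_θG dz dθ = −∬_strip u'(θ)G dz dθ` (no boundary terms). The step "The third term
comes from integrating the transport term by parts" of the proof of [Elgindi2021] Prop. 6.5
(`u = sin(2θ)^{1−γ}`). [cite: Elgindi2021, §6.1, proof of Proposition 6.5 (p. 16 of arXiv:1904.04795)] -/
theorem integral_strip_weight_mul_deriv_slice_snd {G : ℝ × ℝ → ℝ} {u : ℝ → ℝ}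
    (hG : ContDiffOn ℝ 1 G strip) (hGs : HasCompactSupport G) (hGsub : tsupport G ⊆ strip)
    (hu : ContDiffOn ℝ 1 u (Ioo 0 (π / 2))) :
    ∫ p in strip, u p.2 * deriv (fun θ => G (p.1, θ)) p.2 = -∫ p in strip, deriv u p.2 * G p := by
  -- `H = u(θ) G` is `C¹` on the plane with compact support inside the strip
  set H : ℝ × ℝ → ℝ := fun p => u p.2 * G p with hHdef
  have huon : ContDiffOn ℝ 1 (fun p : ℝ × ℝ => u p.2) strip :=
    hu.comp contDiffOn_snd fun p hp => hp.2
  have hHon : ContDiffOn ℝ 1 H strip := huon.mul hG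
  have hH_sub : tsupport H ⊆ tsupport G :=
    tsupport_mul_subset_right (f := fun p : ℝ × ℝ => u p.2) (g := G)
  have hHC : ContDiff ℝ 1 H := contDiff_of_contDiffOn_strip hHon (hH_sub.trans hGsub)
  have hHs : HasCompactSupport H := hGs.mul_left
  have hG0 : ∀ p, p ∉ strip → G p = 0 := fun p hp =>
    image_eq_zero_of_notMem_tsupport fun h => hp (hGsub h)
  -- pointwise on the strip: `∂_θH = u'G + u∂_θG`
  have hpt : ∀ p ∈ strip, deriv (fun θ => H (p.1, θ)) p.2 =
      deriv u p.2 * G p + u p.2 * deriv (fun θ => G (p.1, θ)) p.2 := by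
    intro p hp
    have hud : HasDerivAt u (deriv u p.2) p.2 :=
      ((hu.differentiableOn (by simp) p.2 hp.2).differentiableAt (isOpen_Ioo.mem_nhds hp.2)).hasDerivAt
    have hGd : HasDerivAt (fun θ => G (p.1, θ)) (deriv (fun θ => G (p.1, θ)) p.2) p.2 :=
      (hasDerivAt_slice_snd (differentiableAt_of_contDiffOn_strip hG one_ne_zero hp)).differentiableAt.hasDerivAt
    have := (hud.fun_mul hGd).deriv
    simp only [hHdef] at this ⊢
    rw [this]
  -- off the strip both `G` and `∂_θG` vanish
  have hdG0 : ∀ p : ℝ × ℝ, p ∉ strip → deriv (fun θ => G (p.1, θ)) p.2 = 0 := by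
    intro p hp
    have hev : (fun θ => G (p.1, θ)) =ᶠ[𝓝 p.2] fun _ => 0 := by
      have h0 : G =ᶠ[𝓝 p] 0 := notMem_tsupport_iff_eventuallyEq.1 fun h => hp (hGsub h)
      exact eventuallyEq_slice_snd h0
    rw [hev.deriv_eq, deriv_const]
  have hdH0 : ∀ p : ℝ × ℝ, p ∉ strip → deriv (fun θ => H (p.1, θ)) p.2 = 0 := by
    intro p hp
    have hev : (fun θ => H (p.1, θ)) =ᶠ[𝓝 p.2] fun _ => 0 := by
      have h0 : H =ᶠ[𝓝 p] 0 :=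
        notMem_tsupport_iff_eventuallyEq.1 fun h => hp (hGsub (hH_sub h))
      exact eventuallyEq_slice_snd h0
    rw [hev.deriv_eq, deriv_const]
  -- integrability of the two pieces (continuous with compact support)
  have hu'on : ContinuousOn (fun p : ℝ × ℝ => deriv u p.2) strip :=
    ((hu.continuousOn_deriv_of_isOpen isOpen_Ioo le_rfl).comp continuousOn_snd fun p hp => hp.2)
  have huc : ContinuousOn (fun p : ℝ × ℝ => u p.2) strip := huon.continuousOn
  have hdGc : ContinuousOn (fun p : ℝ × ℝ => deriv (fun θ => G (p.1, θ)) p.2) strip := by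
    have h1 : ContinuousOn (fun p => fderiv ℝ G p) strip := hG.continuousOn_fderiv_of_isOpen isOpen_strip le_rfl
    have h2 : ContinuousOn (fun p => fderiv ℝ G p (0, 1)) strip := h1.clm_apply continuousOn_const
    refine h2.congr fun p hp => ?_
    exact (hasDerivAt_slice_snd (differentiableAt_of_contDiffOn_strip hG one_ne_zero hp)).deriv
  have hKc : IsCompact (tsupport G) := hGs
  have hKcl : IsClosed (tsupport G) := isClosed_tsupport _
  have hcont : ∀ {P : ℝ × ℝ → ℝ}, ContinuousOn P strip → (∀ p, p ∉ tsupport G → P p = 0) → Integrable P := by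
    intro P hP hP0
    have hc : Continuous P := by
      refine continuous_iff_continuousAt.2 fun p => ?_
      by_cases hp : p ∈ tsupport G
      · exact hP.continuousAt (strip_mem_nhds (hGsub hp))
      · have : P =ᶠ[𝓝 p] fun _ => 0 := by
          filter_upwards [hKcl.isOpen_compl.mem_nhds hp] with q hq using hP0 q hq
        exact this.continuousAt
    exact hc.integrable_of_hasCompactSupport (HasCompactSupport.intro hKc hP0)
  have hGt0 : ∀ p, p ∉ tsupport G → G p = 0 := fun p hp => image_eq_zero_of_notMem_tsupport hp
  have hdGt0 : ∀ p : ℝ × ℝ, p ∉ tsupport G → deriv (fun θ => G (p.1, θ)) p.2 = 0 := by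
    intro p hp
    have hev : (fun θ => G (p.1, θ)) =ᶠ[𝓝 p.2] fun _ => 0 :=
      eventuallyEq_slice_snd (notMem_tsupport_iff_eventuallyEq.1 hp)
    rw [hev.deriv_eq, deriv_const]
  have i1 : Integrable fun p : ℝ × ℝ => deriv u p.2 * G p :=
    hcont (hu'on.mul hG.continuousOn) fun p hp => by simp [hGt0 p hp]
  have i2 : Integrable fun p : ℝ × ℝ => u p.2 * deriv (fun θ => G (p.1, θ)) p.2 :=
    hcont (huc.mul hdGc) fun p hp => by simp [hdGt0 p hp]
  -- assemble: `0 = ∬ ∂_θH = ∬_strip (u'G + u∂_θG)`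
  have hzero := integral_deriv_slice_snd_eq_zero hHC hHs
  have e : ∫ p : ℝ × ℝ, deriv (fun θ => H (p.1, θ)) p.2 =
      ∫ p in strip, (deriv u p.2 * G p + u p.2 * deriv (fun θ => G (p.1, θ)) p.2) := by
    rw [← setIntegral_eq_integral_of_forall_compl_eq_zero (s := strip) fun p hp => hdH0 p hp]
    exact setIntegral_congr_fun measurableSet_strip hpt
  rw [e, integral_add i1.integrableOn i2.integrableOn] at hzero
  linarith

/-! ### The `θ`-weighted energy identity -/

/-- **`∬_strip 𝓛(f)·f·w²·ρ(θ) = ½∬_strip (fw)²ρ(θ)`** for `f ∈ C¹` compactly supported inside the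
open strip and a weight `ρ ∈ C¹(0, π/2)` (Elgindi 2021, proofs of Prop. 6.5 and 6.9: the pairings
of `𝓛(D_θf)`, `𝓛(D_zf)` against `w²/sin(2θ)^γ`, `w²/sin(2θ)^η` give "`½|·|²`" exactly as in
Prop. 5.5, (LW) acting in `z` only). [cite: Elgindi2021, §6.1, proofs of Propositions 6.5 and 6.9 (p. 16–17 of arXiv:1904.04795)] -/
theorem integral_strip_opL_energy_weight {f : ℝ → ℝ → ℝ} {ρ : ℝ → ℝ} (hf : ContDiff ℝ 1 (uncurry f))
    (hsupp : HasCompactSupport (uncurry f)) (hsub : tsupport (uncurry f) ⊆ strip)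
    (hρ : ContDiffOn ℝ 1 ρ (Ioo 0 (π / 2))) :
    ∫ p in strip, opL f p.1 p.2 * f p.1 p.2 * radialWeight p.1 ^ 2 * ρ p.2 =
      (1 / 2) * ∫ p in strip, (f p.1 p.2 * radialWeight p.1) ^ 2 * ρ p.2 := by
  set g : ℝ × ℝ → ℝ := fun p => f p.1 p.2 * radialWeight p.1 with hg
  set G : ℝ × ℝ → ℝ := fun p => g p ^ 2 * ρ p.2 with hGdef
  have hw : ContDiffOn ℝ 1 (fun p : ℝ × ℝ => radialWeight p.1) strip := by
    unfold radialWeight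
    refine ContDiffOn.div (by fun_prop) (by fun_prop) fun p hp => ?_
    exact pow_ne_zero 2 (ne_of_gt hp.1)
  have hρon : ContDiffOn ℝ 1 (fun p : ℝ × ℝ => ρ p.2) strip := hρ.comp contDiffOn_snd fun p hp => hp.2
  have hgon : ContDiffOn ℝ 1 g strip := (hf.contDiffOn.congr fun p _ => rfl).mul hw
  have hg_sub : tsupport g ⊆ tsupport (uncurry f) :=
    tsupport_mul_subset_left (f := uncurry f) (g := fun p : ℝ × ℝ => radialWeight p.1)
  have hGon : ContDiffOn ℝ 1 G strip := (hgon.pow 2).mul hρon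
  have hG_sub : tsupport G ⊆ tsupport (uncurry f) := by
    have : G = fun p => g p * (g p * ρ p.2) := by funext p; simp only [hGdef]; ring
    rw [this]
    exact (tsupport_mul_subset_left (f := g) (g := fun p => g p * ρ p.2)).trans hg_sub
  have hGC : ContDiff ℝ 1 G := contDiff_of_contDiffOn_strip hGon (hG_sub.trans hsub)
  have hGs : HasCompactSupport G := by
    have : G = fun p => g p * (g p * ρ p.2) := by funext p; simp only [hGdef]; ring
    rw [this]
    exact (hsupp.mul_right (f' := fun p : ℝ × ℝ => radialWeight p.1)).mul_right
  -- pointwise on the strip: `𝓛(f) f w² ρ = G + ½ z ∂_z G`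
  have hpt : ∀ p ∈ strip, opL f p.1 p.2 * f p.1 p.2 * radialWeight p.1 ^ 2 * ρ p.2 =
      G p + (1 / 2) * (p.1 * deriv (fun z => G (z, p.2)) p.1) := by
    intro p hp
    have hz : p.1 ≠ 0 := ne_of_gt hp.1
    have hz1 : 1 + p.1 ≠ 0 := by have : (0 : ℝ) < p.1 := hp.1; positivity
    have hfd : DifferentiableAt ℝ (uncurry f) p := (hf.differentiable (by norm_num)) p
    have hslice : HasDerivAt (fun z' => f z' p.2) (fderiv ℝ (uncurry f) p (1, 0)) p.1 :=
      hasDerivAt_slice_fst hfd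
    have hLW := opL_mul_radialWeight hz hz1 hslice
    have hgsl : HasDerivAt (fun z' => f z' p.2 * radialWeight z')
        (deriv (fun z' => f z' p.2 * radialWeight z') p.1) p.1 :=
      (hslice.fun_mul (hasDerivAt_radialWeight hz)).differentiableAt.hasDerivAt
    have hGsl : deriv (fun z => G (z, p.2)) p.1 =
        2 * g p * deriv (fun z' => f z' p.2 * radialWeight z') p.1 * ρ p.2 := by
      have := ((hgsl.fun_pow 2).mul_const (ρ p.2)).deriv
      simp only [hGdef, hg] at this ⊢
      rw [this]
      ring
    rw [hGsl]
    simp only [hGdef, hg]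
    have e : opL f p.1 p.2 * f p.1 p.2 * radialWeight p.1 ^ 2 * ρ p.2 =
        (opL f p.1 p.2 * radialWeight p.1) * (f p.1 p.2 * radialWeight p.1) * ρ p.2 := by ring
    rw [e, hLW]
    ring
  have hIG : Integrable G := hGC.continuous.integrable_of_hasCompactSupport hGs
  have hD := integral_fst_mul_deriv_slice_eq_neg hGC hGs
  have hID := integrable_fst_mul_deriv_slice hGC hGs
  have hzero : ∀ p, p ∉ strip → G p = 0 := fun p hp =>
    image_eq_zero_of_notMem_tsupport fun h => hp (hsub (hG_sub h))
  have hzeroD : ∀ p : ℝ × ℝ, p ∉ strip → p.1 * deriv (fun z => G (z, p.2)) p.1 = 0 := by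
    intro p hp
    rw [deriv_slice_fst_eq_zero_of_notMem_tsupport fun h => hp (hsub (hG_sub h)), mul_zero]
  calc ∫ p in strip, opL f p.1 p.2 * f p.1 p.2 * radialWeight p.1 ^ 2 * ρ p.2
      = ∫ p in strip, (G p + (1 / 2) * (p.1 * deriv (fun z => G (z, p.2)) p.1)) :=
        setIntegral_congr_fun measurableSet_strip hpt
    _ = ∫ p, (G p + (1 / 2) * (p.1 * deriv (fun z => G (z, p.2)) p.1)) := by
        refine setIntegral_eq_integral_of_forall_compl_eq_zero fun p hp => ?_
        rw [hzero p hp, hzeroD p hp]; ring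
    _ = (∫ p, G p) + (1 / 2) * ∫ p : ℝ × ℝ, p.1 * deriv (fun z => G (z, p.2)) p.1 := by
        rw [integral_add hIG (hID.const_mul _), integral_const_mul]
    _ = (1 / 2) * ∫ p, G p := by rw [hD]; ring
    _ = (1 / 2) * ∫ p in strip, (f p.1 p.2 * radialWeight p.1) ^ 2 * ρ p.2 := by
        rw [setIntegral_eq_integral_of_forall_compl_eq_zero fun p hp => hzero p hp]

end Elgindi

end Literature.Analysis.FluidPDE
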